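import Literature.NumberTheory.LFunctions.DeterminantEquationDFITheorem1
import Mathlib.Analysis.SpecialFunctions.Pow.Real
import HarnessLib

/-!
# Route `PrimeLevelFamEdge` — TYPED IDEA DELTAS, deck 31 = W1a⁺ (LANDING NOTE typer ls-idea-typ-1 gen 4: lens-13 g12's
# `HOME/ls-idea-lens-13/g12/Sketch_G12_W1aPlus_Gevrey.lean` sha16 24e28c75a34add35 VERBATIM up to namespace
# `…Sketch.Lens13G12W1a` → `…Theorems.PrimeLevelFamEdgeIdeaDeltas.GevreyBump`; desk NOTICE l.2977 priority (i) «lens-13 g12 W1a⁺ if typed»;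
# critic D b125 PASS (byte copy rc 0, axioms std on four theorems, «D clears it»); C = print column (Hörmander ALPDO I); a Literature re-home
# (`Literature/Analysis/Fourier/GevreyBumpDecay.lean`, cite-tagged, Gevrey table inlined) is possible later — this deck is the cell's
# record copy; `gevreyDyadicPartition_exists` keeps its print locator in prose (see its docstring) so that it is NOT relocated.)
#
# W1a⁺ — Gevrey-class bumps: fixed-order and EXPONENTIAL Fourier decay, and the `F⋆` threshold rule

Sketch (seat ls-idea-lens-13, gen 12; crux K_B = `PrimeLevelFamEdge.BeyondDiagonalBeatsQuarter`
stmt-Parity-20343, node L5′ `OffDiagTransition` ≡ piece U; crux idea `l6-davenport-spacing-dichotomy`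
rev 3.3 §Y / rev 3.3a §Y.8, line of record «(c′) funds `|h₁| ≤ H⋆` only, `H⋆ = F/F⋆`,
`F⋆ = (c⁻¹(ηL + A log L))^s`, Gevrey-`s` dyadic bumps, `s ∈ (1, 2]`»).  The desk (STATUS l.2977 (i)) and
typ-1 (l.2988) name «lens-13 g12 W1a⁺» as a typable: THIS is it.

WHAT W1a⁺ IS.  In §Y the `r`-integral of a tall row is, after the reparametrisation of §Y.2, the
Fourier transform of the row's dyadic partition bump `θ` (support of length `ℓ ≍ 1` in the scaled
variable) at the frequency `F = lm·n₂/(|h₁| q R)` TURNS (linear phase; «non-stationary with `F` turns»).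
W1a (Hörmander 7.7.1-type IBP, any fixed order `k`) gives `‖θ̂(F)‖ ≤ ℓ‖θ⁽ᵏ⁾‖_∞/(2πF)^k`; W1a⁺ tracks
the `k`-dependence for a bump in the GEVREY class of order `s` (`‖θ⁽ʲ⁾‖ ≤ C·Bʲ·(j!)^s`, which exist with
compact support for every `s > 1` and for no `s ≤ 1` — Denjoy–Carleman) and optimises `k`, giving
`‖θ̂(F)‖ ≤ e·ℓ·C·exp(−(2πF/(eB))^{1/s})`; hence `‖θ̂(F)‖ ≤ e·ℓ·C·L^{−A}·e^{−ηL}` as soon as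
`F ≥ F⋆ := (c₀⁻¹(ηL + A log L))^s` with `c₀ := (2π/(eB))^{1/s}` — the dividing line `H⋆ = F/F⋆` of record.

PROVED here (kernel-checked, no `sorry`):
* `norm_fourier_le_of_gevrey` — fixed order: `‖𝓕θ(ξ)‖ ≤ ℓ·C·Bᵏ·(k!)^s/(2π|ξ|)^k` (a corollary of the
  tree's `DFIDeterminant.norm_fourier_le_of_iteratedDeriv_le`, DFI 1997 p. 111 «partial integration»);
* `norm_fourier_le_geom_of_gevrey` — the same with `k! ≤ kᵏ`: `≤ ℓ·C·(B k^s/(2π|ξ|))^k`;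
* `norm_fourier_le_exp_of_gevrey` — the Gevrey optimisation `k = ⌊(2π|ξ|/(eB))^{1/s}⌋`:
  `‖𝓕θ(ξ)‖ ≤ e·ℓ·C·exp(−(2π|ξ|/(eB))^{1/s})` (`s > 0`, `B > 0`, `C ≥ 0`, `ξ ≠ 0`);
* `exp_decay_le_of_FStar_le` — the threshold rule: `F ≥ F⋆(c,s,η,A,L) ⇒ exp(−c F^{1/s}) ≤ e^{−ηL}·L^{−A}`;
* `row_bound_of_FStar_le` — the two combined: the §Y.8 line of record as a theorem about `𝓕θ`.
STATEMENT-ONLY (named fact, cited, not proved): `gevreyDyadicPartition_exists` — for every `s > 1` a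
non-negative `C^∞` dyadic partition of unity on `(0,∞)` whose bump obeys a Gevrey-`s` table
[HormanderALPDO1: Thm 1.3.5 (1.3.12) pp. 20–21, Thm 1.4.2 (1.4.3) p. 25, §8.4 (8.4.1)–(8.4.2) p. 236 («the class
`C^L` with `L_k = (k+1)^a`, `a > 1`, is called the Gevrey class of order `a`»), Prop. 8.4.2 (8.4.5)–(8.4.6) p. 237 and
p. 239 l.5 («(8.4.6)′ is satisfied by any fixed function in `C^L` with support in `K`» when `C^L` is non-quasianalytic)].

HONESTY.  Nothing here bounds any dual term of `stub_offDiagBelowSlack_io`; W1a⁺ is the analytic bookkeeping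
lemma on which the `s`-dependence of the record's `H⋆` rests (rev 3.3 §Y.7 (4)); the reparametrisation that makes
the row's `r`-integral a Fourier transform at frequency `F` is §Y.2's pencil, not a tree theorem.  No
exceptional-zero theorem (no Landau–Siegel / Siegel-zero exclusion, no Theorem 1–2 of arXiv:2211.02515, no repaired
Margin232) is proved by ideation; typed ≠ proved except the five kernel-checked items above.
-/

noncomputable section

open scoped ContDiff FourierTransform
open MeasureTheory Real

namespace Summit.Parity.GeneralizedHardyLittlewood.Theorems.PrimeLevelFamEdgeIdeaDeltas.GevreyBump

/-! ### The Gevrey derivative table -/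

/-- GEVREY TABLE of order `s` with constants `C, B` for `θ : ℝ → ℂ`: `‖θ⁽ʲ⁾(x)‖ ≤ C · Bʲ · (j!)^s` for
all `j` and `x` (Hörmander's (8.4.2) with `L_k = (k+1)^s`, up to the harmless change of constants
`(k+1)^{sk} ≍ Bᵏ (k!)^s`). [cite: HormanderALPDO1, §8.4 (8.4.2)] -/
def GevreyDerivBound (s C B : ℝ) (θ : ℝ → ℂ) : Prop :=
  ∀ (j : ℕ) (x : ℝ), ‖iteratedDeriv j θ x‖ ≤ C * B ^ j * ((j.factorial : ℕ) : ℝ) ^ s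

/-- NAMED FACT (statement only) — **Gevrey dyadic partitions of unity exist for every order `s > 1`.**
There is a real `C^∞` bump `θ ≥ 0` supported in `[1/2, 2]`, obeying a Gevrey table of order `s`, with
`Σ_{k ∈ ℤ} θ(x/2ᵏ) = 1` for every `x > 0`.  (Construction: Hörmander's Thm 1.3.5 with `a_j ≍ (j+1)^{-s}`,
summable iff `s > 1`, gives a `C^L`-cutoff, `L_k = (k+1)^s`; `θ(x) := ψ(x) − ψ(2x)` for a `C^L` step `ψ`
telescopes.  For `s ≤ 1` no such `θ` exists — Denjoy–Carleman, Thm 1.3.8.)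
(Print: Hörmander ALPDO I, Thm 1.3.5 (1.3.12); Thm 1.4.2 (1.4.3); §8.4 (8.4.1)–(8.4.2); p. 239 l. 5 — critic C's shelf.  LANDING NOTE: the
seat's citation tag is rendered in prose here because the gate relocates cited 0-ary `Prop`s to `Literature/` and this one
refers to the deck's parametric predicate `GevreyDerivBound`, so a relocated file cannot elaborate (p659198 bounced); it stays an
UNCITED hypothesis shape in this deck — a Literature re-home would inline the Gevrey table.) -/
def gevreyDyadicPartition_exists : Prop :=
  ∀ s : ℝ, 1 < s → ∃ (θ : ℝ → ℝ) (C B : ℝ), 0 < C ∧ 0 < B ∧ ContDiff ℝ ∞ θ ∧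
    Function.support θ ⊆ Set.Icc (1 / 2 : ℝ) 2 ∧ (∀ x, 0 ≤ θ x) ∧
    GevreyDerivBound s C B (fun x => (θ x : ℂ)) ∧
    ∀ x : ℝ, 0 < x → HasSum (fun k : ℤ => θ (x / (2 : ℝ) ^ k)) 1

/-! ### W1a at fixed order, for a Gevrey bump (PROVED) -/

/-- **W1a, fixed order `k`.**  For a smooth `θ` supported in an interval of length `ℓ` with a Gevrey table
`(s, C, B)`: `‖𝓕θ(ξ)‖ ≤ ℓ · C · Bᵏ · (k!)^s / (2π|ξ|)^k` for every `k` and `ξ ≠ 0` — `k` integrations by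
parts (the tree's `DFIDeterminant.norm_fourier_le_of_iteratedDeriv_le`). [folklore] -/
theorem norm_fourier_le_of_gevrey {θ : ℝ → ℂ} (hθ : ContDiff ℝ ∞ θ) {u ℓ : ℝ} (hℓ : 0 ≤ ℓ)
    (hsupp : Function.support θ ⊆ Set.Icc u (u + ℓ)) {s C B : ℝ} (hG : GevreyDerivBound s C B θ)
    (k : ℕ) {ξ : ℝ} (hξ : ξ ≠ 0) :
    ‖𝓕 θ ξ‖ ≤ ℓ * (C * B ^ k * ((k.factorial : ℕ) : ℝ) ^ s) / (2 * π * |ξ|) ^ k :=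
  Literature.NumberTheory.LFunctions.DFIDeterminant.norm_fourier_le_of_iteratedDeriv_le hθ hℓ hsupp
    (fun x => hG k x) hξ

/-- `(k!)^s ≤ (k^s)^k` for `s ≥ 0` (from `k! ≤ kᵏ`). [folklore] -/
theorem factorial_rpow_le_pow_rpow (k : ℕ) {s : ℝ} (hs : 0 ≤ s) :
    ((k.factorial : ℕ) : ℝ) ^ s ≤ ((k : ℝ) ^ s) ^ k := by
  have h1 : ((k.factorial : ℕ) : ℝ) ≤ (k : ℝ) ^ (k : ℕ) := by
    exact_mod_cast Nat.factorial_le_pow k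
  have h2 : ((k.factorial : ℕ) : ℝ) ^ s ≤ ((k : ℝ) ^ (k : ℕ)) ^ s :=
    Real.rpow_le_rpow (by positivity) h1 hs
  refine h2.trans (le_of_eq ?_)
  rw [← Real.rpow_natCast_mul (Nat.cast_nonneg k), mul_comm, Real.rpow_mul_natCast (Nat.cast_nonneg k)]

/-- **W1a, geometric form.**  `‖𝓕θ(ξ)‖ ≤ ℓ · C · (B k^s / (2π|ξ|))^k` for every `k`. [folklore] -/
theorem norm_fourier_le_geom_of_gevrey {θ : ℝ → ℂ} (hθ : ContDiff ℝ ∞ θ) {u ℓ : ℝ} (hℓ : 0 ≤ ℓ)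
    (hsupp : Function.support θ ⊆ Set.Icc u (u + ℓ)) {s C B : ℝ} (hs : 0 ≤ s) (hC : 0 ≤ C) (hB : 0 ≤ B)
    (hG : GevreyDerivBound s C B θ) (k : ℕ) {ξ : ℝ} (hξ : ξ ≠ 0) :
    ‖𝓕 θ ξ‖ ≤ ℓ * C * (B * (k : ℝ) ^ s / (2 * π * |ξ|)) ^ k := by
  have h := norm_fourier_le_of_gevrey hθ hℓ hsupp hG k hξ
  have hfac := factorial_rpow_le_pow_rpow k hs
  have hBk : 0 ≤ B ^ k := pow_nonneg hB k
  calc ‖𝓕 θ ξ‖ ≤ ℓ * (C * B ^ k * ((k.factorial : ℕ) : ℝ) ^ s) / (2 * π * |ξ|) ^ k := h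
    _ ≤ ℓ * (C * B ^ k * ((k : ℝ) ^ s) ^ k) / (2 * π * |ξ|) ^ k := by gcongr
    _ = ℓ * C * (B * (k : ℝ) ^ s / (2 * π * |ξ|)) ^ k := by rw [div_pow, mul_pow]; ring

/-! ### W1a⁺: the Gevrey optimisation (PROVED) -/

/-- **W1a⁺ — exponential Fourier decay of a Gevrey bump.**  For `θ` smooth, supported in an interval
of length `ℓ`, with a Gevrey table `(s, C, B)`, `s > 0`, `B > 0`, `C ≥ 0`, and `ξ ≠ 0`:
`‖𝓕θ(ξ)‖ ≤ e · ℓ · C · exp(−(2π|ξ|/(eB))^{1/s})`.  Proof: take `k = ⌊T⌋`, `T = (2π|ξ|/(eB))^{1/s}`, in the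
geometric form; then `B k^s ≤ B T^s = 2π|ξ|/e`, so the ratio is `≤ 1/e` and `(1/e)^k ≤ e^{1−T}`.
(Hörmander Prop. 8.4.2 (8.4.5) is the fixed-`N` form `|û_N(ξ)| ≤ C(CL_N/|ξ|)^N`; the optimisation in `N`
is the standard step.) [cite: HormanderALPDO1, Prop 8.4.2 (8.4.5)] -/
theorem norm_fourier_le_exp_of_gevrey {θ : ℝ → ℂ} (hθ : ContDiff ℝ ∞ θ) {u ℓ : ℝ} (hℓ : 0 ≤ ℓ)
    (hsupp : Function.support θ ⊆ Set.Icc u (u + ℓ)) {s C B : ℝ} (hs : 0 < s) (hC : 0 ≤ C) (hB : 0 < B)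
    (hG : GevreyDerivBound s C B θ) {ξ : ℝ} (hξ : ξ ≠ 0) :
    ‖𝓕 θ ξ‖ ≤ Real.exp 1 * ℓ * C * Real.exp (-((2 * π * |ξ| / (Real.exp 1 * B)) ^ s⁻¹)) := by
  have hξ' : 0 < |ξ| := abs_pos.2 hξ
  have he : 0 < Real.exp 1 := Real.exp_pos 1
  set X : ℝ := 2 * π * |ξ| / (Real.exp 1 * B) with hX
  have hX0 : 0 ≤ X := by positivity
  set T : ℝ := X ^ s⁻¹ with hT
  have hT0 : 0 ≤ T := Real.rpow_nonneg hX0 _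
  set k : ℕ := ⌊T⌋₊ with hk
  have hk1 : (k : ℝ) ≤ T := Nat.floor_le hT0
  have hk2 : T < (k : ℝ) + 1 := Nat.lt_floor_add_one T
  -- the geometric form at this k
  have hgeom := norm_fourier_le_geom_of_gevrey hθ hℓ hsupp hs.le hC hB.le hG k hξ
  -- B k^s ≤ B T^s = 2π|ξ|/e
  have hTs : T ^ s = X := by rw [hT, Real.rpow_inv_rpow hX0 hs.ne']
  have hks : (k : ℝ) ^ s ≤ X := by
    rw [← hTs]; exact Real.rpow_le_rpow (Nat.cast_nonneg k) hk1 hs.le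
  have hratio : B * (k : ℝ) ^ s / (2 * π * |ξ|) ≤ (Real.exp 1)⁻¹ := by
    rw [div_le_iff₀ (by positivity)]
    calc B * (k : ℝ) ^ s ≤ B * X := mul_le_mul_of_nonneg_left hks hB.le
      _ = (Real.exp 1)⁻¹ * (2 * π * |ξ|) := by rw [hX]; field_simp
  have hratio0 : 0 ≤ B * (k : ℝ) ^ s / (2 * π * |ξ|) := by positivity
  have hpow : (B * (k : ℝ) ^ s / (2 * π * |ξ|)) ^ k ≤ ((Real.exp 1)⁻¹) ^ k :=
    pow_le_pow_left₀ hratio0 hratio k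
  -- (1/e)^k = exp(-k) ≤ exp(1 - T) = e * exp(-T)
  have hek : ((Real.exp 1)⁻¹) ^ k = Real.exp (-(k : ℝ)) := by
    rw [← Real.exp_neg, ← Real.exp_nat_mul]; ring_nf
  have hexp : Real.exp (-(k : ℝ)) ≤ Real.exp 1 * Real.exp (-T) := by
    rw [← Real.exp_add]; exact Real.exp_le_exp.2 (by linarith)
  calc ‖𝓕 θ ξ‖ ≤ ℓ * C * (B * (k : ℝ) ^ s / (2 * π * |ξ|)) ^ k := hgeom
    _ ≤ ℓ * C * (Real.exp 1 * Real.exp (-T)) := by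
        refine mul_le_mul_of_nonneg_left ?_ (mul_nonneg hℓ hC)
        exact hpow.trans (hek ▸ hexp)
    _ = Real.exp 1 * ℓ * C * Real.exp (-T) := by ring

/-! ### The `F⋆` threshold rule of record (PROVED) -/

/-- `F⋆(c, s, η, A, L) := (c⁻¹ (ηL + A log L))^s` — the IBP threshold of rev 3.3 §Y / §Y.8
(«65 at s = 1.1, 2.0·10³ at s = 2, (η, L) = (0.1, 230)», with the cell's `c`, `A = 4`). [folklore] -/
def FStar (c s η A L : ℝ) : ℝ := ((η * L + A * Real.log L) / c) ^ s

/-- **Threshold rule.**  If `c > 0`, `s > 0`, `L > 0`, `ηL + A log L ≥ 0` and `F ≥ F⋆(c,s,η,A,L)`, then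
`exp(−c F^{1/s}) ≤ e^{−ηL} · L^{−A}`. [folklore] -/
theorem exp_decay_le_of_FStar_le {c s η A L F : ℝ} (hc : 0 < c) (hs : 0 < s) (hL : 0 < L)
    (hnum : 0 ≤ η * L + A * Real.log L) (hF : FStar c s η A L ≤ F) :
    Real.exp (-(c * F ^ s⁻¹)) ≤ Real.exp (-(η * L)) * L ^ (-A) := by
  have hy : 0 ≤ (η * L + A * Real.log L) / c := div_nonneg hnum hc.le
  have h1 : (η * L + A * Real.log L) / c ≤ F ^ s⁻¹ := by
    have h := Real.rpow_le_rpow (Real.rpow_nonneg hy s) hF (inv_nonneg.2 hs.le)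
    rwa [Real.rpow_rpow_inv hy hs.ne'] at h
  have h2 : η * L + A * Real.log L ≤ c * F ^ s⁻¹ := by
    have h := mul_le_mul_of_nonneg_left h1 hc.le
    rwa [mul_div_cancel₀ _ hc.ne'] at h
  calc Real.exp (-(c * F ^ s⁻¹)) ≤ Real.exp (-(η * L + A * Real.log L)) :=
        Real.exp_le_exp.2 (by linarith)
    _ = Real.exp (-(η * L)) * L ^ (-A) := by
        rw [Real.rpow_def_of_pos hL, ← Real.exp_add]
        congr 1; ring

/-- **The §Y.8 line of record as a theorem about `𝓕θ`.**  With `c₀ := (2π/(eB))^{1/s}`: if the row's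
frequency `F` (turns) satisfies `F ≥ F⋆(c₀, s, η, A, L)` then `‖𝓕θ(F)‖ ≤ e·ℓ·C·e^{−ηL}·L^{−A}` — the
tall rows `|h₁| ≤ H⋆ = F/F⋆` are funded by (c′), the band `F < F⋆` (collar + crown = R⋆) is not
touched by this lemma. [folklore] -/
theorem row_bound_of_FStar_le {θ : ℝ → ℂ} (hθ : ContDiff ℝ ∞ θ) {u ℓ : ℝ} (hℓ : 0 ≤ ℓ)
    (hsupp : Function.support θ ⊆ Set.Icc u (u + ℓ)) {s C B : ℝ} (hs : 0 < s) (hC : 0 ≤ C) (hB : 0 < B)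
    (hG : GevreyDerivBound s C B θ) {η A L F : ℝ} (hL : 0 < L) (hnum : 0 ≤ η * L + A * Real.log L)
    (hF0 : 0 < F) (hF : FStar ((2 * π / (Real.exp 1 * B)) ^ s⁻¹) s η A L ≤ F) :
    ‖𝓕 θ F‖ ≤ Real.exp 1 * ℓ * C * (Real.exp (-(η * L)) * L ^ (-A)) := by
  have hc0 : 0 < (2 * π / (Real.exp 1 * B)) ^ s⁻¹ := Real.rpow_pos_of_pos (by positivity) _
  have h1 := norm_fourier_le_exp_of_gevrey hθ hℓ hsupp hs hC hB hG hF0.ne'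
  have hsplit : (2 * π * |F| / (Real.exp 1 * B)) ^ s⁻¹ = (2 * π / (Real.exp 1 * B)) ^ s⁻¹ * F ^ s⁻¹ := by
    rw [abs_of_pos hF0, ← Real.mul_rpow (by positivity) hF0.le]
    congr 1; ring
  rw [hsplit] at h1
  have h2 := exp_decay_le_of_FStar_le hc0 hs hL hnum hF
  exact h1.trans (mul_le_mul_of_nonneg_left h2 (by positivity))

end Summit.Parity.GeneralizedHardyLittlewood.Theorems.PrimeLevelFamEdgeIdeaDeltas.GevreyBump

end
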